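import Mathlib.AlgebraicGeometry.Morphisms.Smooth
import Mathlib.AlgebraicGeometry.Morphisms.Separated
import Mathlib.AlgebraicGeometry.Morphisms.QuasiCompact
import Mathlib.AlgebraicGeometry.Morphisms.UnderlyingMap
import Mathlib.AlgebraicGeometry.IdealSheaf.Functorial
import Mathlib.AlgebraicGeometry.AffineScheme
import Mathlib.Algebra.Polynomial.Laurent
import Mathlib.RingTheory.Localization.Away.Basic
import Mathlib.RingTheory.RegularLocalRing.Defs
import Mathlib.RingTheory.Ideal.Cotangent
import Mathlib.FieldTheory.Perfect
import Mathlib.Algebra.CharP.Defs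
import Literature.AlgebraicGeometry.Resolution.ResolutionOfSingularities
import HarnessLib

/-!
# Weighted resolution data (the interface posited by route `WeightedInvariant`)

Topic: `Literature/AlgebraicGeometry/Resolution`. Definition request `defn-WeightedResolutionDatum`
(route `ResolutionOfSingularities/WeightedInvariant`; consumers: crux `WeightedConstruction`
= `Nonempty (WeightedResolutionDatum p)` for every prime `p`, stmt-0571, and support
`DatumToResolution`, stmt-8974).

A **weighted resolution datum in characteristic `p`** is EVIDENCE (a `Type 1`-valued structure,
not a claim): a single well-ordered value set `Γ` and, for every perfect field `k` of
characteristic `p`, every smooth separated `k`-scheme of finite type `f : Y → Spec k` and every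
closed subscheme `X ⊆ Y` (an ideal sheaf, Mathlib `Scheme.IdealSheafData`), an
upper-semicontinuous function `inv : |Y| → Γ` together with a **weighted centre** on `Y` — the
shape of the characteristic-zero theorems of Abramovich–Temkin–Włodarczyk (2024, Thm. 1.1.1:
"a functor `F_er`, on pairs with smooth surjective morphisms, associating to a pair `X ⊂ Y` … a
center `J̄` with weighted blowing up `Y' → Y` and proper transform `(X' ⊂ Y') = F_er(X ⊂ Y)` such
that `maxinv(X') < maxinv(X)`") and of Włodarczyk's torus-action reformulation (arXiv:2203.03090,
Thms. 1.1.4, 1.1.6, §3.3.33 "Resolution principle": `maxinv_X = maxinv_B > maxinv_{B_+}`), with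
the characteristic-zero-specific content (derivatives, maximal contact) abstracted away and the
refuter checklist of stmt-0569 built in:

* `(usc)` superlevel sets `{y | γ ≤ inv y}` are closed (the form used by
  `Summits/…/Theorems/WeightedInvariantTermination.lean`: on a Noetherian space such an `inv`
  takes finitely many values and attains its maximum);
* `(i)` `inv` is functorial for SMOOTH morphisms `g : Y₁ → Y` (pull `X` back: `X.comap g`) and for
  extensions `k → K` of PERFECT ground fields (base change along `Spec K → Spec k`); the centre is
  functorial for smooth SURJECTIVE morphisms and for such base changes (ATW: "functor on pairs
  with smooth surjective morphisms"; Włodarczyk Thm. 1.1.4 (6): "functoriality holds for smooth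
  morphisms, field extensions, and group actions") — functoriality under the two smooth
  surjective maps `act, pr : 𝔾ₘ × Y → Y` is what makes `inv` and the centres torus-invariant, so
  no torus needs to be carried in the state;
* `(ii)` `inv y` is the minimum of `Γ` iff `y ∉ X` or the local ring of `X` at `y` is regular
  (Mathlib `IsRegularLocalRing`, as in `Scheme.IsRegular`) — history-free, no boundary;
* `(iii)` ONLY WHEN `inv` is not everywhere minimal: the centre is a REGULAR WEIGHTED CENTRE
  (Włodarczyk 2.1.10: "a Q-ideal locally of the form `(u₁^{a₁}, …, u_k^{a_k})` where … `uᵢ` are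
  part of a system of parameters", recorded through its Rees algebra `⊕ₙ Jₙ tⁿ`,
  `Jₙ = (u^α : Σ wᵢ αᵢ ≥ n)`, Lemma 2.1.12) whose support is exactly the maximum locus of `inv`;
* `(iv)` (same guard) THE TRANSFORM IS PINNED TO GEOMETRY: over every affine open `U = Spec A` of
  `Y` form Włodarczyk's cobordant blow-up `B = Spec A[t⁻¹, Jₙ(U) tⁿ]` (Def. 2.3.5), remove the
  vertex `V(Jₙ tⁿ : n ≥ 1)` to get `B₊`, take the strict transform of `X` (the `t⁻¹`-saturation
  of `I_X · 𝒪_B`, 3.3.12) — then `inv` of `(B₊ → U → Y → Spec k, strict transform)` is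
  STRICTLY BELOW `max_Y inv` at every point of `B₊` (Thm. 4.3.1 / §3.3.33 shape). Because `inv` is
  local (axiom `(i)` for open immersions), this chart-wise statement is equivalent to the drop on
  the global cobordant blow-up `B₊ = Spec_Y(⊕ₙ Jₙ tⁿ) ∖ Vert → Y` (definition request
  `defn-CobordantBlowup`, which glues these very charts), and it needs no stacks: `B`, `B₊` are
  schemes.

## What is NOT an axiom (consequences / assembly-side theorems)

* `B₊` is again smooth over `k` (Włodarczyk 2.3.9: "`B` is a regular closed subscheme of
  `X × 𝔸ⁿ⁺¹`"): `inv` is a TOTAL function of `(f, X)` (junk values allowed outside the smooth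
  separated finite-type regime), so `(iv)` is stated without smoothness hypotheses on `B₊`.
* For `X` reduced and unresolved the centre is nowhere dense in `X`: by `(ii)` `inv` is minimal
  at the generic points of `X` (their local rings are fields), and by `(iii)` the centre is the
  maximum locus; `WeightedResolutionDatum.support_centre_subset` records the first half
  (centre ⊆ `X`).
* Termination (finitely many values of `inv`) is `finite_range_of_isClosed_superlevel` in
  `Summits/ResolutionOfSingularities/…/Theorems/WeightedInvariantTermination.lean`.

## Refuter checklist (stmt-0569 notes, 2026-08-13) and how it is met

* g4-6 (a) / g4-2 F2 (transform pinned, no abstract `transform` field): `(iv)` is about the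
  explicit schemes `ReesAlgebraData.cobordantPlus` and ideal sheaves
  `ReesAlgebraData.cobordantStrictTransform`; the junk data "transform := (Y, ∅)" is not
  expressible.
* g4-6 (b): "resolved" is `IsRegularLocalRing` of the stalks of `X.subscheme` (`(ii)`).
* g4-6 (c): provable, see above.  * g4-6 (d): `(usc)` in superlevel form.
* g4-2 F1: only PERFECT ground fields occur (`[PerfectField k]`, `[PerfectField K]`); every
  extension of a perfect field is separable, so `(i)`/`(ii)` are consistent (regularity of a
  finite-type scheme over a perfect field is smoothness, which is insensitive to base change).
  All extensions `k → K` of perfect fields are allowed, not only algebraic ones, as in the printed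
  functoriality "for field extensions" (Włodarczyk Thm. 1.1.4 (6)).
* g4-2 F3: no destackification inside the datum (`B₊` is a scheme; the torus quotient is the
  assembly's business, stmt-8974).  * g4-2 F4 / g10-2 F6: ONE `Γ` for all dimensions, datum
  indexed by `p` only, so functoriality along smooth morphisms of positive relative dimension is
  well-typed.
* g4-7 F5: `(iii)`/`(iv)` carry the guard `∃ y, ¬ IsBot (inv y)`.

## Contents

* `extReesAlgebra I` (for `I : ℕ → Ideal A`): Włodarczyk's extended Rees algebra
  `A[t⁻¹, Iₙ tⁿ] ⊆ A[t, t⁻¹]` (Def. 2.3.5 with 2.2: `R^ext = R[t⁻¹]`), its element `tInv = t⁻¹`,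
  its `vertexIdeal = (Iₙ tⁿ : n ≥ 1)` and the strict transform `strictTransform I 𝔞` of an ideal
  `𝔞 ≤ A` (`t⁻¹`-saturation of `𝔞 · A[t⁻¹, Iₙ tⁿ]`, 3.3.12), with `mem_strictTransform_iff`.
* `affineCobordantBlowup I = Spec A[t⁻¹, Iₙ tⁿ]` (the full cobordant blow-up `B` of `Spec A`),
  `affineCobordantBlowup.π`, `.vertex`, `.plusOpens` / `.plus` (`B₊ = B ∖ Vert(B)`), `.plusπ`
  (`σ₊`), `.strictTransformPlus`.
* `ReesAlgebraData Y`: the graded pieces `ℕ → Y.IdealSheafData` of a Rees algebra on a scheme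
  (Włodarczyk §2.2), with `support`, `chartIdeals`, `cobordantPlus`, `cobordantPlusι`,
  `cobordantStrictTransform`; `weightedMonomialIdeal u w n = (u^α : Σ wᵢ αᵢ ≥ n)`;
  `ReesAlgebraData.IsWeightedChart` / `ReesAlgebraData.IsRegularWeightedCentre` (2.1.10–2.1.12),
  `IsWeightedChart.mem_support_iff` (the support of a charted centre is `V(u)`), the unit Rees
  algebra `ReesAlgebraData.unit` (empty centre; `isRegularWeightedCentre_unit`, `support_unit`).
* `WeightedResolutionDatum p` — the structure; API: `not_isBot_of_isMaxOn`,
  `isBot_inv_of_not_mem_support`, `isBot_inv_iff_of_mem_support`, `support_centre_subset`.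

## Sources

* J. Włodarczyk, *Functorial resolution by torus actions*, arXiv:2203.03090: Def. 2.1.8,
  2.1.10, Lemmas 2.1.11–2.1.12, §2.2, Def. 2.3.5, Lemma 2.3.8, 2.3.9, Rem. 2.3.10, 3.3.12,
  Rem. 3.3.13, §3.3.33, Thm. 4.3.1, Thms. 1.1.4, 1.1.6. [Wlodarczyk2022]
* D. Abramovich, M. Temkin, J. Włodarczyk, *Functorial embedded resolution via weighted blowings
  up*, Algebra Number Theory 18 (2024), Thm. 1.1.1, §1.9. [AbramovichTemkinWlodarczyk2024]
-/

noncomputable section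

open CategoryTheory CategoryTheory.Limits AlgebraicGeometry TopologicalSpace
open scoped LaurentPolynomial

namespace Literature.AlgebraicGeometry.Resolution

universe u

/-! ## The extended Rees algebra of a filtration and the affine cobordant blow-up -/

section Affine

variable {A : Type u} [CommRing A]

/-- The **extended Rees algebra** `A[t⁻¹, Iₙ tⁿ : n ≥ 1] ⊆ A[t, t⁻¹]` of a sequence of ideals
`I : ℕ → Ideal A` (meant: the graded pieces of a Rees algebra, `I₀ = A`, `Iₘ Iₙ ⊆ Iₘ₊ₙ`): the
`A`-subalgebra of the Laurent polynomial ring generated by `t⁻¹` and the `a tⁿ`, `a ∈ Iₙ`, `n ≥ 1`.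
For the regular weighted centre `J = (u₁^{1/w₁}, …, u_k^{1/w_k})`, `Iₙ = (u^α : Σ wᵢαᵢ ≥ n)`,
this is Włodarczyk's `A^ext_J = 𝒪_X[t⁻¹, u₁ t^{w₁}, …, u_k t^{w_k}]` (2.2.8, Lemma 2.1.11), whose
`Spec` is the full cobordant blow-up (Def. 2.3.5). [cite: Wlodarczyk2022, §2.2 and Def. 2.3.5] -/
def extReesAlgebra (I : ℕ → Ideal A) : Subalgebra A A[T;T⁻¹] :=
  Algebra.adjoin A (insert (LaurentPolynomial.T (-1))
    {x | ∃ n : ℕ, 0 < n ∧ ∃ a ∈ I n, x = LaurentPolynomial.C a * LaurentPolynomial.T (n : ℤ)})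

namespace extReesAlgebra

variable (I : ℕ → Ideal A)

/-- The element `t⁻¹` (Włodarczyk's `s = t⁻¹`, Rem. 2.3.10) of the extended Rees algebra; its
zero locus on `B₊` is the exceptional divisor (Lemma 2.3.8). [cite: Wlodarczyk2022, Rem. 2.3.10] -/
def tInv : extReesAlgebra I :=
  ⟨LaurentPolynomial.T (-1), Algebra.subset_adjoin (Set.mem_insert _ _)⟩

/-- `tInv` is the Laurent monomial `T⁻¹`. [folklore] -/
@[simp]
theorem coe_tInv : (tInv I : A[T;T⁻¹]) = LaurentPolynomial.T (-1) := rfl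

/-- The generators `a tⁿ` (`n ≥ 1`, `a ∈ Iₙ`) lie in the extended Rees algebra. [folklore] -/
theorem C_mul_T_mem {n : ℕ} (hn : 0 < n) {a : A} (ha : a ∈ I n) :
    LaurentPolynomial.C a * LaurentPolynomial.T (n : ℤ) ∈ extReesAlgebra I :=
  Algebra.subset_adjoin (Set.mem_insert_of_mem _ ⟨n, hn, a, ha, rfl⟩)

/-- The **vertex ideal** `(a tⁿ : n ≥ 1, a ∈ Iₙ)` of the extended Rees algebra: its zero locus in
the full cobordant blow-up `B = Spec A[t⁻¹, Iₙ tⁿ]` is the vertex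
`Vert(B) = V(t^{w₁} u₁, …, t^{w_k} u_k)` (Def. 2.3.5; §2.2: "the vertex of `R` is
`V(Σ_{a>0} R_a)`"). [cite: Wlodarczyk2022, Def. 2.3.5] -/
def vertexIdeal : Ideal (extReesAlgebra I) :=
  Ideal.span {x | ∃ n : ℕ, 0 < n ∧ ∃ a ∈ I n,
    (x : A[T;T⁻¹]) = LaurentPolynomial.C a * LaurentPolynomial.T (n : ℤ)}

/-- The **strict transform** of an ideal `𝔞 ≤ A` under the full cobordant blow-up: the
`t⁻¹`-saturation of `𝔞 · A[t⁻¹, Iₙ tⁿ]`, i.e. `{g | (t⁻¹)^m g ∈ 𝔞 · A[t⁻¹, Iₙ tⁿ] for some m}`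
(Włodarczyk 3.3.12: "`σˢ(I) := {tᵃ f ∈ 𝒪_B | f ∈ 𝒪_B · I, a ≥ 0}`", the schematic closure of
`(𝒪_B · I)|_{B_-}`, `B_- = B ∖ V(t⁻¹) = X × 𝔾ₘ`); rendered as the contraction of the extension
to the localisation `A[t⁻¹, Iₙ tⁿ][t]`. See `mem_strictTransform_iff`.
[cite: Wlodarczyk2022, 3.3.12] -/
def strictTransform (𝔞 : Ideal A) : Ideal (extReesAlgebra I) :=
  ((𝔞.map (algebraMap A (extReesAlgebra I))).map
    (algebraMap (extReesAlgebra I) (Localization.Away (tInv I)))).comap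
    (algebraMap (extReesAlgebra I) (Localization.Away (tInv I)))

/-- Membership in the strict transform: `g ∈ σˢ(𝔞)` iff `(t⁻¹)^m · g ∈ 𝔞 · A[t⁻¹, Iₙ tⁿ]` for
some `m` (Włodarczyk 3.3.12). [cite: Wlodarczyk2022, 3.3.12] -/
theorem mem_strictTransform_iff {𝔞 : Ideal A} {g : extReesAlgebra I} :
    g ∈ strictTransform I 𝔞 ↔
      ∃ m : ℕ, tInv I ^ m * g ∈ 𝔞.map (algebraMap A (extReesAlgebra I)) := by
  set J := 𝔞.map (algebraMap A (extReesAlgebra I)) with hJ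
  set L := Localization.Away (tInv I)
  constructor
  · intro hg
    rw [strictTransform, Ideal.mem_comap] at hg
    obtain ⟨⟨⟨j, hj⟩, ⟨m, hm⟩⟩, e⟩ :=
      (IsLocalization.mem_map_algebraMap_iff (Submonoid.powers (tInv I)) L).mp hg
    obtain ⟨n, rfl⟩ := (Submonoid.mem_powers_iff _ _).mp hm
    -- `g * t⁻ⁿ = j` in the localisation, hence `t⁻ᶜ (g t⁻ⁿ) = t⁻ᶜ j` in the ring
    obtain ⟨⟨c, hc⟩, hc'⟩ := (IsLocalization.eq_iff_exists (Submonoid.powers (tInv I)) L).mp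
      (show algebraMap _ L (g * tInv I ^ n) = algebraMap _ L j by simpa [map_mul] using e)
    obtain ⟨c', rfl⟩ := (Submonoid.mem_powers_iff _ _).mp hc
    refine ⟨c' + n, ?_⟩
    have : tInv I ^ (c' + n) * g = tInv I ^ c' * (g * tInv I ^ n) := by ring
    rw [this, hc']
    exact J.mul_mem_left _ hj
  · rintro ⟨m, hm⟩
    rw [strictTransform, Ideal.mem_comap]
    have hu : IsUnit (algebraMap (extReesAlgebra I) L (tInv I ^ m)) := by
      rw [map_pow]
      exact (IsLocalization.Away.algebraMap_isUnit (tInv I)).pow m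
    have hmem : algebraMap _ L (tInv I ^ m * g) ∈ J.map (algebraMap _ L) :=
      Ideal.mem_map_of_mem _ hm
    rw [map_mul] at hmem
    exact (Ideal.unit_mul_mem_iff_mem _ hu).mp hmem

/-- The extension of `𝔞` lies in its strict transform. [folklore] -/
theorem map_le_strictTransform (𝔞 : Ideal A) :
    𝔞.map (algebraMap A (extReesAlgebra I)) ≤ strictTransform I 𝔞 := by
  intro g hg
  exact (mem_strictTransform_iff I).mpr ⟨0, by simpa using hg⟩

end extReesAlgebra

/-- The **full cobordant blow-up** `B = Spec A[t⁻¹, Iₙ tⁿ]` of the affine scheme `Spec A` along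
the Rees algebra with pieces `Iₙ` (Włodarczyk, Def. 2.3.5: "`B := Spec_X(𝒪_X[t⁻¹, t^{w₁}x₁, …,
t^{w_k}x_k])`", the affine case; it carries the `𝔾ₘ`-action of the `ℤ`-grading, not recorded
here). [cite: Wlodarczyk2022, Def. 2.3.5] -/
def affineCobordantBlowup (I : ℕ → Ideal A) : Scheme.{u} :=
  Spec (.of (extReesAlgebra I))

namespace affineCobordantBlowup

variable (I : ℕ → Ideal A)

/-- The projection `B → Spec A` of the full cobordant blow-up. [cite: Wlodarczyk2022, Def. 2.3.5] -/
def π : affineCobordantBlowup I ⟶ Spec (.of A) :=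
  Spec.map (CommRingCat.ofHom (algebraMap A (extReesAlgebra I)))

/-- The ideal sheaf on `B = Spec A[t⁻¹, Iₙ tⁿ]` of an ideal of the ring `A[t⁻¹, Iₙ tⁿ]`.
[folklore] -/
def idealSheaf (J : Ideal (extReesAlgebra I)) : (affineCobordantBlowup I).IdealSheafData :=
  Scheme.IdealSheafData.ofIdealTop (J.map (Scheme.ΓSpecIso (.of (extReesAlgebra I))).inv.hom)

/-- The ideal sheaf of the **vertex** `Vert(B) = V(Iₙ tⁿ : n ≥ 1)` of the full cobordant blow-up
(Def. 2.3.5). [cite: Wlodarczyk2022, Def. 2.3.5] -/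
def vertex : (affineCobordantBlowup I).IdealSheafData :=
  idealSheaf I (extReesAlgebra.vertexIdeal I)

/-- The ideal sheaf of the **exceptional divisor** `D = V(t⁻¹)` of the full cobordant blow-up
(Lemma 2.3.8: `J · 𝒪_{B₊} = t⁻¹ · 𝒪_{B₊}`). [cite: Wlodarczyk2022, Lemma 2.3.8] -/
def exceptional : (affineCobordantBlowup I).IdealSheafData :=
  idealSheaf I (Ideal.span {extReesAlgebra.tInv I})

/-- `B₊ = B ∖ Vert(B)` as an open of the full cobordant blow-up (Def. 2.3.5: "`B₊ := B ∖
V(t^{w₁}x₁, …, t^{w_k}x_k)` … the complement of the vertex"). [cite: Wlodarczyk2022, Def. 2.3.5] -/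
def plusOpens : (affineCobordantBlowup I).Opens :=
  ⟨((vertex I).support : Set (affineCobordantBlowup I))ᶜ, (vertex I).support.isClosed.isOpen_compl⟩

/-- The **cobordant blow-up** `B₊ = B ∖ Vert(B)` of `Spec A` along the Rees algebra with pieces
`Iₙ`, as a scheme (Def. 2.3.5; over a field its stack quotient `[B₊/𝔾ₘ]` is the weighted
blow-up, Rem. 2.3.6 — not used). [cite: Wlodarczyk2022, Def. 2.3.5] -/
def plus : Scheme.{u} :=
  plusOpens I

/-- The cobordant blow-up morphism `σ₊ : B₊ → Spec A` (Def. 2.3.5).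
[cite: Wlodarczyk2022, Def. 2.3.5] -/
def plusπ : plus I ⟶ Spec (.of A) :=
  (plusOpens I).ι ≫ π I

/-- The **strict transform on `B₊`** of the closed subscheme `V(𝔞) ⊆ Spec A`: the restriction to
`B₊` of the ideal sheaf of `σˢ(𝔞)` (Włodarczyk 3.3.12 and Rem. 3.3.13: on `B₊` "the induced
strict transform agrees with the classical definition"). [cite: Wlodarczyk2022, 3.3.12–3.3.13] -/
def strictTransformPlus (𝔞 : Ideal A) : (plus I).IdealSheafData :=
  (idealSheaf I (extReesAlgebra.strictTransform I 𝔞)).comap (plusOpens I).ι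

end affineCobordantBlowup

/-- The **monomial ideals of a weighted chart**: for elements `u₁, …, uₘ` of `A` with weights
`w₁, …, wₘ`, `weightedMonomialIdeal u w n = (u^α : Σᵢ wᵢ αᵢ ≥ n)` — the degree-`n` piece of the
Rees algebra of the weighted centre `(u₁^{1/w₁}, …, uₘ^{1/wₘ})` (Włodarczyk, Lemma 2.1.12:
"`(Jᵃ)_X = I_{ν,a} = (u^α | Σ αᵢwᵢ ≥ a)`"; Def. 2.1.8). Degenerate cases, as printed: a unit
among the `uᵢ` (with positive weight) makes every piece the unit ideal (the centre is empty on
this chart); `m = 0` gives the unit ideal in degree `0` and the ZERO ideal in positive degrees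
(the zero centre, whose cobordant blow-up `B₊` is empty). [cite: Wlodarczyk2022, Lemma 2.1.12] -/
def weightedMonomialIdeal {m : ℕ} (u : Fin m → A) (w : Fin m → ℕ) (n : ℕ) : Ideal A :=
  Ideal.span {x | ∃ α : Fin m → ℕ, n ≤ ∑ i, w i * α i ∧ x = ∏ i, u i ^ α i}

/-- In degree `0` the monomial ideal is the unit ideal (`α = 0` gives the empty product `1`).
[folklore] -/
theorem weightedMonomialIdeal_zero {m : ℕ} (u : Fin m → A) (w : Fin m → ℕ) :
    weightedMonomialIdeal u w 0 = ⊤ := by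
  rw [weightedMonomialIdeal, Ideal.eq_top_iff_one]
  exact Ideal.subset_span ⟨0, by simp, by simp⟩

/-- The monomial ideals decrease with the degree. [folklore] -/
theorem weightedMonomialIdeal_antitone {m : ℕ} (u : Fin m → A) (w : Fin m → ℕ) :
    Antitone (weightedMonomialIdeal u w) := by
  intro n n' h
  apply Ideal.span_mono
  rintro x ⟨α, hα, rfl⟩
  exact ⟨α, h.trans hα, rfl⟩

end Affine

/-! ## Rees algebras on a scheme and regular weighted centres -/

/-- The graded pieces of an (`ℕ`-graded) **Rees algebra** `R = ⊕ₙ Rₙ tⁿ ⊆ 𝒪_Y[t]` on a scheme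
`Y` (Włodarczyk §2.2: "`R₀ = 𝒪_X`, and `R_a · R_b ⊆ R_{a+b}`"; finite generation is not
recorded), each piece a quasi-coherent ideal sheaf (Mathlib `Scheme.IdealSheafData`). Regular
weighted centres `J = (u₁^{1/w₁}, …, u_k^{1/w_k})` are recorded through their Rees algebras
`A_J = ⊕ₐ (Jᵃ)_X tᵃ` (Lemma 2.1.11, 2.2.8), which determine the cobordant blow-up
(Def. 2.3.5). [cite: Wlodarczyk2022, §2.2] -/
structure ReesAlgebraData (Y : Scheme.{u}) where
  /-- the degree-`n` piece `Rₙ ⊆ 𝒪_Y` -/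
  piece : ℕ → Y.IdealSheafData
  /-- `R₀ = 𝒪_Y` -/
  piece_zero : piece 0 = ⊤
  /-- `Rₘ · Rₙ ⊆ Rₘ₊ₙ` -/
  piece_mul_le : ∀ m n, piece m * piece n ≤ piece (m + n)

namespace ReesAlgebraData

variable {Y : Scheme.{u}} (R : ReesAlgebraData Y)

/-- The **vertex / support** `V(R) = V(Σ_{n>0} Rₙ) = ⋂_{n>0} V(Rₙ)` of a Rees algebra (Włodarczyk
§2.2); for the Rees algebra of a weighted centre `(u₁^{1/w₁}, …, u_k^{1/w_k})` this is
`V(u₁, …, u_k)`. [cite: Wlodarczyk2022, §2.2] -/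
def support : Set Y :=
  ⋂ (n : ℕ) (_ : 0 < n), ((R.piece n).support : Set Y)

/-- Membership in the support: `y` lies in `V(Rₙ)` for every `n > 0`. [folklore] -/
theorem mem_support_iff {y : Y} :
    y ∈ R.support ↔ ∀ n : ℕ, 0 < n → y ∈ (R.piece n).support := by
  simp [support, Set.mem_iInter]

/-- The pieces of `R` over an affine open `U`, as ideals of `Γ(Y, U)`. [folklore] -/
def chartIdeals (U : Y.affineOpens) : ℕ → Ideal Γ(Y, U) :=
  fun n => (R.piece n).ideal U

/-- Unfolding `chartIdeals`. [folklore] -/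
@[simp]
theorem chartIdeals_apply (U : Y.affineOpens) (n : ℕ) : R.chartIdeals U n = (R.piece n).ideal U :=
  rfl

/-- The cobordant blow-up `B₊(U) = Spec(Γ(U)[t⁻¹, Rₙ(U) tⁿ]) ∖ Vert` of the affine open `U ⊆ Y`
along `R|_U` (Włodarczyk Def. 2.3.5, affine case). [cite: Wlodarczyk2022, Def. 2.3.5] -/
def cobordantPlus (U : Y.affineOpens) : Scheme.{u} :=
  affineCobordantBlowup.plus (R.chartIdeals U)

/-- `B₊(U) → Spec Γ(Y, U) ≅ U ⊆ Y`: the cobordant blow-up of the chart followed by the open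
immersion of the chart. [cite: Wlodarczyk2022, Def. 2.3.5] -/
def cobordantPlusι (U : Y.affineOpens) : R.cobordantPlus U ⟶ Y :=
  affineCobordantBlowup.plusπ (R.chartIdeals U) ≫ U.2.fromSpec

/-- The strict transform on `B₊(U)` of the closed subscheme `X ∩ U` of the chart `U`
(Włodarczyk 3.3.12–3.3.13). [cite: Wlodarczyk2022, 3.3.12] -/
def cobordantStrictTransform (U : Y.affineOpens) (X : Y.IdealSheafData) :
    (R.cobordantPlus U).IdealSheafData :=
  affineCobordantBlowup.strictTransformPlus (R.chartIdeals U) (X.ideal U)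

/-- **Weighted chart.** On the affine open `U ⊆ Y`, the Rees algebra `R` is the Rees algebra of
the regular weighted centre `(u₁^{1/w₁}, …, uₘ^{1/wₘ})`: the weights are positive, every piece
`Rₙ(U)` is the monomial ideal `(u^α : Σ wᵢαᵢ ≥ n)` (Lemma 2.1.12), and `u₁, …, uₘ` are part of a
regular system of parameters at every point `y` of `V(u) ∩ U` — rendered: their classes in the
cotangent space `𝔪_y/𝔪_y²` of `𝒪_{Y,y}` are linearly independent over `κ(y)`, which for the
regular local rings `𝒪_{Y,y}` of the schemes this is used on (smooth over a field) is exactly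
"part of a regular system of parameters", and in general says "part of a minimal system of
generators of `𝔪_y`" (2.1.10: "`uᵢ` are part of a system of parameters" on a regular scheme;
Def. 2.1.8). Away from the centre one presents `R|_U = 𝒪_U[t]` by a
unit parameter (`isRegularWeightedCentre_unit`); `m = 0` presents the zero centre
(`Rₙ(U) = 0` for `n > 0`, support all of `U`, `B₊(U) = ∅`), which a datum can never use on a
non-empty chart under the guard of `(iii)` (the generic points of `Y` are never in the maximum
locus, by `(ii)`). [cite: Wlodarczyk2022, 2.1.10 and Lemma 2.1.12] -/
structure IsWeightedChart (U : Y.affineOpens) {m : ℕ} (u : Fin m → Γ(Y, U)) (w : Fin m → ℕ) :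
    Prop where
  /-- weights are positive integers -/
  w_pos : ∀ i, 0 < w i
  /-- `Rₙ(U) = (u^α : Σ wᵢ αᵢ ≥ n)` -/
  ideal_eq : ∀ n, (R.piece n).ideal U = weightedMonomialIdeal u w n
  /-- at every point of `U` where all `uᵢ` vanish, the `uᵢ` are part of a regular system of
  parameters of `𝒪_{Y,y}` -/
  linearIndependent : ∀ (y : Y) (hy : y ∈ (U : Y.Opens))
    (h : ∀ i, (Y.presheaf.germ (U : Y.Opens) y hy).hom (u i) ∈
      IsLocalRing.maximalIdeal (Y.presheaf.stalk y)),
    LinearIndependent (IsLocalRing.ResidueField (Y.presheaf.stalk y))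
      (fun i => (IsLocalRing.maximalIdeal (Y.presheaf.stalk y)).toCotangent ⟨_, h i⟩)

/-- `R` **is (the Rees algebra of) a regular weighted centre** on `Y`: every point of `Y` has an
affine open neighbourhood carrying a weighted chart (Włodarczyk 2.1.10: "A regular weighted center
on a regular scheme `X` is a Q-ideal locally of the form `(u₁^{a₁}, …, u_k^{a_k})`, where
`aᵢ ∈ ℚ_{>0}` and `uᵢ` are part of a system of parameters", with Lemma 2.1.11/2.2.8:
`J = (u₁^{1/w₁}, …, u_k^{1/w_k})`, `wᵢ ∈ ℕ`, corresponds to `A_J = 𝒪_X[u₁t^{w₁}, …, u_kt^{w_k}]`).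
[cite: Wlodarczyk2022, 2.1.10] -/
def IsRegularWeightedCentre (R : ReesAlgebraData Y) : Prop :=
  ∀ y : Y, ∃ U : Y.affineOpens, y ∈ (U : Y.Opens) ∧
    ∃ (m : ℕ) (u : Fin m → Γ(Y, U)) (w : Fin m → ℕ), R.IsWeightedChart U u w

/-- **The support of a charted centre is `V(u)`**: for a weighted chart `(U, u, w)` of `R` and a
point `y` of `U`, `y` lies in the support `V(R)` iff every parameter `uᵢ` vanishes at `y`
(Włodarczyk 2.1.10: the centre `(u₁^{1/w₁}, …, uₘ^{1/wₘ})` is supported on `V(u₁, …, uₘ)`).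
[cite: Wlodarczyk2022, 2.1.10] -/
theorem IsWeightedChart.mem_support_iff {U : Y.affineOpens} {m : ℕ} {u : Fin m → Γ(Y, U)}
    {w : Fin m → ℕ} (h : R.IsWeightedChart U u w) {y : Y} (hy : y ∈ (U : Y.Opens)) :
    y ∈ R.support ↔ ∀ i, y ∉ Y.basicOpen (u i) := by
  rw [R.mem_support_iff]
  simp_rw [Scheme.IdealSheafData.mem_support_iff_of_mem hy, h.ideal_eq, weightedMonomialIdeal,
    Scheme.zeroLocus_span, Scheme.mem_zeroLocus_iff, Set.mem_setOf_eq]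
  constructor
  · intro H i
    refine H (w i) (h.w_pos i) (u i) ⟨Pi.single i 1, ?_, ?_⟩
    · rw [Finset.sum_eq_single i (fun j _ hj => by simp [hj])
        (fun hi => absurd (Finset.mem_univ i) hi)]
      simp
    · rw [Finset.prod_eq_single i (fun j _ hj => by simp [hj])
        (fun hi => absurd (Finset.mem_univ i) hi)]
      simp
  · rintro H n hn _ ⟨α, hα, rfl⟩
    -- some exponent is positive since `0 < n ≤ Σ wⱼ αⱼ`
    obtain ⟨i, hi⟩ : ∃ i, 0 < α i := by
      by_contra hcon
      push Not at hcon
      have hsum : ∑ j, w j * α j = 0 :=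
        Finset.sum_eq_zero fun j _ => by rw [Nat.le_zero.mp (hcon j), mul_zero]
      omega
    intro hmem
    rw [← Finset.mul_prod_erase Finset.univ (fun j => u j ^ α j) (Finset.mem_univ i),
      Scheme.basicOpen_mul, Y.basicOpen_pow (u i) hi] at hmem
    exact H i (TopologicalSpace.Opens.mem_inf.mp hmem).1

variable (Y) in
/-- The **unit Rees algebra** `𝒪_Y[t]` (every piece the unit ideal): the empty weighted centre.
Its extended algebra is `𝒪_Y[t, t⁻¹]`, its cobordant blow-up the trivial one `B = B₊ = Y × 𝔾ₘ`
(Def. 2.3.5, "trivial cobordant blow-up"). A convenient total value for `centre` off the guard.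
[cite: Wlodarczyk2022, Def. 2.3.5] -/
def unit : ReesAlgebraData Y where
  piece _ := ⊤
  piece_zero := rfl
  piece_mul_le _ _ := le_top

/-- The unit Rees algebra has every piece equal to `⊤`. [folklore] -/
@[simp]
theorem unit_piece (n : ℕ) : (unit Y).piece n = ⊤ := rfl

/-- The unit Rees algebra has empty support. [folklore] -/
theorem support_unit : (unit Y).support = ∅ := by
  ext y
  simp only [mem_support_iff, unit_piece, Scheme.IdealSheafData.support_top,
    Set.mem_empty_iff_false, iff_false, not_forall]
  exact ⟨1, Nat.one_pos, fun h => h⟩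

/-- With a unit parameter of positive weight every weighted monomial ideal is the unit ideal.
[folklore] -/
theorem weightedMonomialIdeal_one {A : Type*} [CommRing A] (n : ℕ) :
    weightedMonomialIdeal (fun _ : Fin 1 => (1 : A)) (fun _ => 1) n = ⊤ := by
  rw [weightedMonomialIdeal, Ideal.eq_top_iff_one]
  exact Ideal.subset_span ⟨fun _ => n, by simp, by simp⟩

/-- **Non-vacuity of `IsRegularWeightedCentre`**: the unit Rees algebra (empty centre) is a
regular weighted centre — around every point, the chart with the single unit parameter `1` of
weight `1` (no point of the chart lies on `V(1) = ∅`). [folklore] -/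
theorem isRegularWeightedCentre_unit : (unit Y).IsRegularWeightedCentre := by
  intro y
  obtain ⟨U, hU, hyU, -⟩ :=
    exists_isAffineOpen_mem_and_subset (X := Y) (x := y) (U := ⊤) (Opens.mem_top y)
  refine ⟨⟨U, hU⟩, hyU, 1, fun _ => 1, fun _ => 1, ⟨fun _ => Nat.one_pos, fun n => ?_, ?_⟩⟩
  · rw [unit_piece, Scheme.IdealSheafData.ideal_top, weightedMonomialIdeal_one]
    rfl
  · intro y' hy' h
    exfalso
    have h0 := h 0
    rw [map_one] at h0
    exact (IsLocalRing.maximalIdeal.isMaximal _).ne_top (Ideal.eq_top_of_isUnit_mem _ h0 isUnit_one)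

end ReesAlgebraData

/-! ## The datum -/

/-- **Weighted resolution datum in characteristic `p`** (the interface posited by route
`ResolutionOfSingularities/WeightedInvariant`; shape of Abramovich–Temkin–Włodarczyk 2024,
Thm. 1.1.1, and Włodarczyk arXiv:2203.03090, Thms. 1.1.4/1.1.6, §3.3.33, Thm. 4.3.1, with the
characteristic-zero construction abstracted into axioms). EVIDENCE, not a claim: the claim
`∀ p prime, Nonempty (WeightedResolutionDatum p)` is the route's crux `WeightedConstruction`.

Data: a linearly ordered, well-founded value type `Γ`; for every field `k`, every `k`-scheme
`f : Y → Spec k` and every ideal sheaf `X` on `Y` a TOTAL function `inv f X : Y → Γ` and a Rees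
algebra `centre f X` on `Y` (junk outside the regime of the axioms). Axioms, for `k` PERFECT of
characteristic `p` and `f` smooth, separated and quasi-compact (hence of finite type):
`(usc)` closed superlevel sets; `(i)` functoriality of `inv` for smooth `k`-morphisms and perfect
ground-field extensions, of `centre` for smooth surjective `k`-morphisms and perfect ground-field
extensions; `(ii)` `inv` minimal exactly off `X` and at the points where `X` is regular;
and, when `inv` is not everywhere minimal, `(iii)` the centre is a regular weighted centre
supported exactly on the maximum locus and `(iv)` on the cobordant blow-up `B₊(U)` of every affine
chart `U`, with the strict transform of `X`, `inv` is everywhere strictly below `max_Y inv`.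
See the module docstring for the checklist this answers and for what is deliberately NOT an
axiom. [cite: AbramovichTemkinWlodarczyk2024, Thm. 1.1.1; Wlodarczyk2022, §3.3.33 and Thm. 4.3.1] -/
structure WeightedResolutionDatum (p : ℕ) : Type 1 where
  /-- the value set of the invariant (one for all dimensions) -/
  Γ : Type
  /-- `Γ` is linearly ordered … -/
  [linearOrder : LinearOrder Γ]
  /-- … and well-ordered -/
  [wellFoundedLT : WellFoundedLT Γ]
  /-- the invariant `inv_{(Y,X)} : |Y| → Γ` of a closed subscheme `X` (ideal sheaf) of a
  `k`-scheme `f : Y → Spec k` (total; meaningful for `k` perfect of char `p`, `f` smooth separated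
  of finite type) -/
  inv : ∀ ⦃k : Type⦄ [Field k] ⦃Y : Scheme.{0}⦄, (Y ⟶ Spec (.of k)) → Y.IdealSheafData → Y → Γ
  /-- the weighted centre of `(Y, X)`, as a Rees algebra on `Y` (total; meaningful under the
  guard of `(iii)`/`(iv)`) -/
  centre : ∀ ⦃k : Type⦄ [Field k] ⦃Y : Scheme.{0}⦄, (Y ⟶ Spec (.of k)) → Y.IdealSheafData →
    ReesAlgebraData Y
  /-- `(usc)` upper semicontinuity: superlevel sets are closed -/
  isClosed_superlevel : ∀ ⦃k : Type⦄ [Field k] [CharP k p] [PerfectField k] ⦃Y : Scheme.{0}⦄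
    (f : Y ⟶ Spec (.of k)) [Smooth f] [IsSeparated f] [QuasiCompact f] (X : Y.IdealSheafData)
    (γ : Γ), IsClosed {y : Y | γ ≤ inv f X y}
  /-- `(i)` functoriality of `inv` for smooth `k`-morphisms `g : Y₁ → Y` (`X` pulled back) -/
  inv_comap : ∀ ⦃k : Type⦄ [Field k] [CharP k p] [PerfectField k] ⦃Y Y₁ : Scheme.{0}⦄
    (f : Y ⟶ Spec (.of k)) [Smooth f] [IsSeparated f] [QuasiCompact f]
    (f₁ : Y₁ ⟶ Spec (.of k)) [Smooth f₁] [IsSeparated f₁] [QuasiCompact f₁]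
    (g : Y₁ ⟶ Y) [Smooth g], g ≫ f = f₁ →
    ∀ (X : Y.IdealSheafData) (y₁ : Y₁), inv f₁ (X.comap g) y₁ = inv f X (g y₁)
  /-- `(i)` functoriality of `inv` for extensions `φ : k → K` of perfect ground fields
  (`Y_K → Y` the base change along `Spec K → Spec k`) -/
  inv_baseChange : ∀ ⦃k : Type⦄ [Field k] [CharP k p] [PerfectField k]
    ⦃K : Type⦄ [Field K] [PerfectField K] (φ : k →+* K)
    ⦃Y YK : Scheme.{0}⦄ (f : Y ⟶ Spec (.of k)) [Smooth f] [IsSeparated f] [QuasiCompact f]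
    (fK : YK ⟶ Spec (.of K)) (pr : YK ⟶ Y),
    IsPullback pr fK f (Spec.map (CommRingCat.ofHom φ)) →
    ∀ (X : Y.IdealSheafData) (y : YK), inv fK (X.comap pr) y = inv f X (pr y)
  /-- `(ii)` `inv` is minimal at `y` iff `y ∉ X` or the local ring of `X` at `y` is regular
  (the points of `X.subscheme` over `y`: none off the support, one on it) -/
  isBot_inv_iff : ∀ ⦃k : Type⦄ [Field k] [CharP k p] [PerfectField k] ⦃Y : Scheme.{0}⦄
    (f : Y ⟶ Spec (.of k)) [Smooth f] [IsSeparated f] [QuasiCompact f] (X : Y.IdealSheafData)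
    (y : Y), IsBot (inv f X y) ↔
      ∀ x : X.subscheme, X.subschemeι x = y → IsRegularLocalRing (X.subscheme.presheaf.stalk x)
  /-- `(iii)` [guard: `inv` not everywhere minimal] the centre is a regular weighted centre … -/
  isRegularWeightedCentre_centre : ∀ ⦃k : Type⦄ [Field k] [CharP k p] [PerfectField k]
    ⦃Y : Scheme.{0}⦄ (f : Y ⟶ Spec (.of k)) [Smooth f] [IsSeparated f] [QuasiCompact f]
    (X : Y.IdealSheafData), (∃ y : Y, ¬ IsBot (inv f X y)) →
    (centre f X).IsRegularWeightedCentre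
  /-- `(iii)` … supported exactly on the maximum locus of `inv` -/
  support_centre : ∀ ⦃k : Type⦄ [Field k] [CharP k p] [PerfectField k]
    ⦃Y : Scheme.{0}⦄ (f : Y ⟶ Spec (.of k)) [Smooth f] [IsSeparated f] [QuasiCompact f]
    (X : Y.IdealSheafData), (∃ y : Y, ¬ IsBot (inv f X y)) →
    (centre f X).support = {y : Y | ∀ y' : Y, inv f X y' ≤ inv f X y}
  /-- `(i)` for the centre: functoriality for smooth SURJECTIVE `k`-morphisms -/
  centre_comap : ∀ ⦃k : Type⦄ [Field k] [CharP k p] [PerfectField k] ⦃Y Y₁ : Scheme.{0}⦄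
    (f : Y ⟶ Spec (.of k)) [Smooth f] [IsSeparated f] [QuasiCompact f]
    (f₁ : Y₁ ⟶ Spec (.of k)) [Smooth f₁] [IsSeparated f₁] [QuasiCompact f₁]
    (g : Y₁ ⟶ Y) [Smooth g] [Surjective g], g ≫ f = f₁ →
    ∀ (X : Y.IdealSheafData), (∃ y : Y, ¬ IsBot (inv f X y)) →
    ∀ n : ℕ, (centre f₁ (X.comap g)).piece n = ((centre f X).piece n).comap g
  /-- `(i)` for the centre: functoriality for extensions of perfect ground fields -/
  centre_baseChange : ∀ ⦃k : Type⦄ [Field k] [CharP k p] [PerfectField k]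
    ⦃K : Type⦄ [Field K] [PerfectField K] (φ : k →+* K)
    ⦃Y YK : Scheme.{0}⦄ (f : Y ⟶ Spec (.of k)) [Smooth f] [IsSeparated f] [QuasiCompact f]
    (fK : YK ⟶ Spec (.of K)) (pr : YK ⟶ Y),
    IsPullback pr fK f (Spec.map (CommRingCat.ofHom φ)) →
    ∀ (X : Y.IdealSheafData), (∃ y : Y, ¬ IsBot (inv f X y)) →
    ∀ n : ℕ, (centre fK (X.comap pr)).piece n = ((centre f X).piece n).comap pr
  /-- `(iv)` [guard] the invariant DROPS on the cobordant blow-up: for every affine chart `U` of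
  `Y`, at every point of `B₊(U)` (structure map `B₊(U) → U ⊆ Y → Spec k`, strict transform of
  `X`), `inv` is strictly below the maximum of `inv` on `Y` -/
  inv_cobordantPlus_lt : ∀ ⦃k : Type⦄ [Field k] [CharP k p] [PerfectField k]
    ⦃Y : Scheme.{0}⦄ (f : Y ⟶ Spec (.of k)) [Smooth f] [IsSeparated f] [QuasiCompact f]
    (X : Y.IdealSheafData), (∃ y : Y, ¬ IsBot (inv f X y)) →
    ∀ (U : Y.affineOpens) (b : (centre f X).cobordantPlus U) (y : Y),
      (∀ y' : Y, inv f X y' ≤ inv f X y) →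
      inv ((centre f X).cobordantPlusι U ≫ f) ((centre f X).cobordantStrictTransform U X) b
        < inv f X y

namespace WeightedResolutionDatum

variable {p : ℕ} (D : WeightedResolutionDatum p)

/-- The value set of a datum is linearly ordered (structure field as an instance). [folklore] -/
instance instLinearOrder : LinearOrder D.Γ := D.linearOrder

/-- The value set of a datum is well-ordered (structure field as an instance). [folklore] -/
instance instWellFoundedLT : WellFoundedLT D.Γ := D.wellFoundedLT

section

variable {k : Type} [Field k] {Y : Scheme.{0}} (f : Y ⟶ Spec (.of k)) (X : Y.IdealSheafData)

/-- A point where `inv` is maximal is not a point where `inv` is minimal, as soon as `inv` is not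
everywhere minimal. [folklore] -/
theorem not_isBot_of_isMaxOn (h : ∃ y : Y, ¬ IsBot (D.inv f X y)) {y : Y}
    (hy : ∀ y' : Y, D.inv f X y' ≤ D.inv f X y) : ¬ IsBot (D.inv f X y) := by
  obtain ⟨y₀, hy₀⟩ := h
  intro hbot
  exact hy₀ fun γ => (hy y₀).trans (hbot γ)

variable [CharP k p] [PerfectField k] [Smooth f] [IsSeparated f] [QuasiCompact f]

/-- Off `X` the invariant is minimal (one direction of `(ii)`). [folklore] -/
theorem isBot_inv_of_not_mem_support {y : Y} (hy : y ∉ X.support) : IsBot (D.inv f X y) := by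
  rw [D.isBot_inv_iff f X y]
  intro x hx
  exfalso
  apply hy
  have hmem : X.subschemeι x ∈ (X.support : Set Y) := by
    rw [← X.range_subschemeι]
    exact ⟨x, rfl⟩
  rw [← hx]
  exact hmem

/-- `(ii)` at a point of `X`: `inv` is minimal at `y ∈ X` iff the local ring `𝒪_{X,y}` (the stalk
of Mathlib's `X.subscheme`, whose points are the points of the support) is a regular local ring.
[folklore] -/
theorem isBot_inv_iff_of_mem_support {y : Y} (hy : y ∈ X.support) :
    IsBot (D.inv f X y) ↔ IsRegularLocalRing (X.subscheme.presheaf.stalk ⟨y, hy⟩) := by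
  rw [D.isBot_inv_iff f X y]
  constructor
  · intro h
    exact h ⟨y, hy⟩ rfl
  · intro h x hx
    obtain rfl : x = ⟨y, hy⟩ := Subtype.ext hx
    exact h

/-- **The centre lies inside `X`** (first half of checklist item g4-6 (c) / g4-2 F2: for reduced
unresolved `X` the centre is nowhere dense in `X`): under the guard of `(iii)`, the support of
the centre — the maximum locus of `inv` — is contained in the support of `X`, because off `X` the
invariant is minimal by `(ii)`. [folklore] -/
theorem support_centre_subset (h : ∃ y : Y, ¬ IsBot (D.inv f X y)) :
    (D.centre f X).support ⊆ X.support := by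
  intro y hy
  rw [D.support_centre f X h] at hy
  by_contra hyX
  exact D.not_isBot_of_isMaxOn f X h hy (D.isBot_inv_of_not_mem_support f X hyX)

end

end WeightedResolutionDatum

end Literature.AlgebraicGeometry.Resolution

end
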